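import Summits.QuantumFields.YangMills.Theses.IsotropyFromPowerCounting
import Summits.QuantumFields.YangMills.Theorems.DiagonalMirrorRPRTwistedTrace
import Summits.QuantumFields.YangMills.Theorems.PencilRigidityDiagonalMirrorRPRStubRpClosureDefs
import Summits.QuantumFields.YangMills.Theorems.MirrorModularBoostsHypercubicLimitCouplingResponseDefsC
import Summits.QuantumFields.YangMills.Theorems.DiagonalMirrorRPRDiagonalSliceModelDefs
import Summits.QuantumFields.YangMills.Theorems.DiagonalMirrorRPROddTorusSwapPairingDefs
import Summits.QuantumFields.YangMills.Theorems.DiagonalMirrorRPRTwistLettersDefs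
import Summits.QuantumFields.YangMills.Theorems.DiagonalMirrorRPRTwistedTraceSeries
import Summits.QuantumFields.YangMills.Theorems.DiagonalMirrorRPRSignTwistedCore
import Summits.QuantumFields.YangMills.Theorems.PencilRigidityWeakCouplingHypercubicLimitRPDiagRPOfSwapPairing
import Summits.QuantumFields.YangMills.Theorems.DiagonalMirrorRPRWilsonDiagonalModelPinned

/-!
# Crux `DiagonalMirrorRPR` (stmt-QuantumFields-10604), line `sign-twisted-diagonal-trace`: the W₁-free CORE

Crux-plan workfile for the crux idea `Cruxes/DiagonalMirrorRPR/Ideas/sign-twisted-diagonal-trace.md` (crux-ideate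
seat 1, critic verdict idea-crit-9 g12 #108 PASS-WITH-PRICE, annex P5–P6; director docket director-ym g22, o4cluster
INBOX 2026-08-31T12:47Z).  Routes wanting the crux: `IsotropyFromPowerCounting` (primary), `MirrorModularBoosts`,
`PencilRigidity`.  HONEST LINE: ⟨10604⟩ and ⟨17721⟩ are OPEN; the crux `DiagonalMirrorRPR` AS TYPED is misstated
(pending the F (FOLD) restate) and NOTHING here concludes it; the Yang–Mills mass gap is NOT proved here or anywhere in
the tree.  By the docket this file deliberately contains NO `DiagonalMirrorRPR_of`.

## What this file does

* §1 types the lattice statement the line actually proves, `OddTorusSwapPairingLiminf r sch`: on the scheme's OWN odd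
  tori (side `2L_k+1`), for every finite family of products of smeared curvature fields with compact supports in the
  open half-space `{x₁ < x₀}` and its mirror family under the coordinate SWAP `x₀ ↔ x₁`, the real Gram pairing has
  `liminf_k ≥ 0`.  TYPING NOTE (flag for idea-crit-9 g12): the seat-1 sketch used the anti-diagonal mirror
  `σ(x) = (−x₁, −x₀, x₂, x₃)`; this file uses the swap `x₀ ↔ x₁` because (i) the corner-based curvature species is
  EXACTLY swap-covariant on the lattice (`smearedLatticeField_swap`, landed) so the swap pairing is an honest lattice
  Gram form, and (ii) the landed canonical frame of the closure argument, `R e₀ = c (e₀ − e₁)`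
  (`RpClosure.psd_canonical`), has frame reflection `R⁻¹ ∘ swap₀₁ = θ ∘ R⁻¹` — i.e. the swap IS the mirror the
  conclusion `DiagonalFrameRP` needs; the two mirrors are conjugate by the W(B₄) clause of the package.
* §2 posits the INTERFACE `DiagonalSliceModel r sch` (a structure, no existence smuggled): the sequence spectral model
  of the self-adjoint odd root `A_k = K_k W_k^{-1/2}` of the diagonal transfer operator on the slice `x₀ − x₁ = const`
  of the `k`-th odd torus, split by the sign `U = sgn A_k` into the `U`-even moduli `sp k ·` and the `U`-odd moduli
  `sm k ·`, with the top modulus `top k`, kernel positivity of the odd traces (`trace_nonneg`, `trace_side_pos`: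
  `Tr A^m` is a twisted-torus partition function), and for every reflected family `F` Gram weights `wp, wm ≥ 0`, a
  depth, the PAIRING IDENTITY `⟨ΘF·F⟩_k · Tr A^S = Tr (X A^{S−2d}) = Σ sp^{S−2d} wp − Σ sm^{S−2d} wm` and the WEIGHT
  DOMINATION `Tr (X |A|^{2t}) ≤ ‖F‖_∞² Tr |A|^{2t+2d}` (positive kernels).  Its CONSTRUCTION for Wilson's measure is
  the registered-size-L stub `stub_wilsonDiagonalModel` (F1_diag of the card).
* §3 types the door-B LETTERS on an explicit model binder `𝔪` (never on a chosen / universal model, never as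
  consequences of the package W₁ — critic P1/P2): R1 `OddTwistGap 𝔪` (the `U`-odd sector of `A_k` is spectrally
  suppressed by `exp(−γ a_k)` relative to the top, `U = sgn A_k`, NOT a momentum sector — annex A5), R2
  `DiagLukewarm 𝔪` (`Tr (|A_k|/λ₀)^{2t} ≤ C` for `t ≥ θ·side_k`, some `θ < 1/2`: the B2 growth clause, not B1), and
  the scheme clause `Growth r sch = TemperateRenormalisation ∧ SideGrowth`; §3b PROVES the adapters
  `growth_of_poly : PolyRenorm r sch → PolyCounterterm r sch → PolyVolume sch → Growth r sch` to the clauses of the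
  fired door-B stub `stub_diagRPOfPlaneLimits` that are already in the tree
  (`…Cruxes.HypercubicLimit.CouplingResponse.PolyRenorm`, `.PolyVolume`, cited by name).
* §4 proves the diagonal (spectral) form of the landed sign-twisted trace bound — the finite-dimensional operator
  statements are `twistedTraceBound` / `evenPartNonneg` of `Theorems/DiagonalMirrorRPRTwistedTrace.lean` (✓p822576,
  ✓p822604), cited BY NAME and not re-stubbed — and the real-analysis core `pairing_lower_bound`.
* §4b PROVES the docket's stub S1 in multiplet form, `sectorTopStateEven` (the top multiplet of `|A_k|` has at
  least as many `U`-even as `U`-odd states; Tannery's theorem along odd exponents), and §5 PROVES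
  `core_of : OddTwistGap 𝔪 → DiagLukewarm 𝔪 → Growth r sch → OddTorusSwapPairingLiminf r sch` OUTRIGHT — no `sorry`
  in its closure (`#print axioms core_of` = propext, Classical.choice, Quot.sound).
* §6 P6 of the annex verdict FIRST: the wrong-sign (`U`-odd) sector is provably NON-EMPTY and weight-carrying whenever a
  finite-`k` pairing is negative (`oddSector_weight_of_pairing_neg`) — which the landed negatives exhibit
  (`Disproof.lean` §4 `SquareTorusNotSwapRP`, `OddTorusTwist`, the Ising witness `Ising3.pairing_eq`); plus a toy
  instance with negative pairing at EVERY `k` and `liminf = 0`.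
* §7 the closure stub `stub_closure : CurvaturePackage r sch S₁ → OddTorusSwapPairingLiminf r sch → DiagonalFrameRP S₁`
  (size M; the landed `RpClosure.psd_canonical` pattern run on the scheme's own torus through `hconv`, no cover) and
  the door-B composition `diagonalFrameRP_of_twistLetters`.

Sorries: ONLY inside `stub_*`.  `set_option autoImplicit false`; no instances, no notation.

References: Osterwalder–Seiler, Ann. Phys. 110 (1978) §2–3 (transfer matrix, RP for lattice gauge theory);
Fröhlich–Israel–Lieb–Simon, Comm. Math. Phys. 62 (1978) Thm 2.1; Kanazawa arXiv:0808.3442 Lemma 2 and Tomboulis–Yaffe,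
Comm. Math. Phys. 100 (1985) (sign / multiplet structure of twisted transfer matrices); Seiler LNP 159 Ch. 2.
-/

/-! ## κ4 (2026-08-31, critic idea-crit-9 g12 bytes on director-ym g23 O4 WORD 22 (3)): THIN WRAPPER
Since the door-B chain was RE-HOMED under `Theorems/` by hand-10604-wilsonDiagModel-2 g0 (same FQNs, this namespace):
§1 socket `OddTorusSwapPairingLiminf` → `Theorems/DiagonalMirrorRPROddTorusSwapPairingDefs.lean` (p827497);
§2 `DiagonalSliceModel` → `Theorems/DiagonalMirrorRPRDiagonalSliceModelDefs.lean` (p825205, κ1);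
§3/§3b letters `OddTwistGap`/`DiagLukewarm`/`TemperateRenormalisation` (κ3 form)/`SideGrowth`/`Growth`/`TwistLetters`/
`PolyRenormCounterterm`/`PolyCounterterm` + adapters (+ `…_of_ufbPlanes`, + `.subseq`/`.restrict`) →
`Theorems/DiagonalMirrorRPRTwistLettersDefs.lean` (p827648), `…FamObsGrowth.lean` (p827519), `…DiagonalSliceModelRestrict.lean` (p827367);
§4/§4b analysis + even top state → `Theorems/DiagonalMirrorRPRTwistedTraceSeries.lean` (p827631);
§5 `core_of` and its chain → `Theorems/DiagonalMirrorRPRSignTwistedCore.lean` (p827779);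
this workfile now IMPORTS them and keeps only what is not in the tree: `tendsto_a_mul_side`, §6 `oddSector_weight_of_pairing_neg`
and the toy `toy_wrongSign`, §7 the two line stubs — of which `stub_closure` is now DISCHARGED by the landed generic transfer
(p827255) — and `diagonalFrameRP_of_twistLetters`.  The registered use of this line is on the ONE-ID crux ⟨stmt-QuantumFields-27398⟩
(`Cruxes/WeakCouplingHypercubicLimitRP/Lines/Sketch.lean` v2 97b02a6fc0a363ac, stub D1′ `stub_oddTorusSwapPairingLiminf`), where
`Theorems/PencilRigidityWeakCouplingHypercubicLimitRPDiagRPOfTwistLetters.lean` (p827816) composes `core_of` with the transfer.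
Only `stub_wilsonDiagonalModel` remains sorried here (hand-3's `wilsonDiagonalModel`, docket P1–P4+A).  Nothing proved toward the
summit; YM mass gap NOT proved. -/

/-! ## κ5 (2026-08-31, hand-10604-wilsonDiagModel-2 g2 bytes): `stub_wilsonDiagonalModel` DISCHARGED by the landed PINNED model
`WilsonDiagonal.wilsonDiagonalTransferModel r sch hβ : DiagonalSliceModel r sch` (`Theorems/DiagonalMirrorRPRWilsonDiagonalModelPinned.lean`, p830030:
slice data by explicit formulas from the chosen eigen-package of hand-1's self-adjoint realisation of the two-step diagonal transfer matrix; pairing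
layer P3–P4 of hand-2 g2 on top of hand-1's 26 and hand-2 g0's 5 construction files).  This workfile is now SORRY-FREE; the open content of door B is
exactly the letters R1 `OddTwistGap (wilsonDiagonalTransferModel …)` (⟺ a sign gap of the negative eigenvalues, `…PinnedLetters`) / R2 `DiagLukewarm (…)`
(or R2♭ `DiagTepid`, `…TepidLetters`).  Nothing proved toward the summit; YM mass gap NOT proved. -/

set_option autoImplicit false

noncomputable section

open scoped SchwartzMap
open MeasureTheory Filter Topology
open Literature.MathematicalPhysics.QuantumLattice Literature.MathematicalPhysics.AQFT
  Literature.MathematicalPhysics.QuantumFieldTheory Literature.Probability.LatticeModels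
open Summit.QuantumFields.YangMills.Cruxes.DiagonalMirrorRPR.ParityBridgeColdTraces (E4 CurvaturePackage DiagonalFrameRP)
open Summit.QuantumFields.YangMills.Cruxes.DiagonalMirrorRPR.ParityBridgeColdTraces.RpClosure (swap01)

namespace Summit.QuantumFields.YangMills.Cruxes.DiagonalMirrorRPR.SignTwistedDiagonalTrace

/-! ## §1 The lattice statement of the line (swap mirror on the scheme's own odd tori) -/

section Statement

variable {G : Type} [Group G] [TopologicalSpace G] [IsTopologicalGroup G] [CompactSpace G]
  [MeasurableSpace G] [BorelSpace G]

end Statement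

/-! ## §2 The interface: the two-sector spectral model of the odd root of the diagonal transfer operator -/

-- §2 body (structure `DiagonalSliceModel r sch` with fields sp/sm/top/…/pairing_eq/weight_dom) now lives in
-- `Summits.QuantumFields.YangMills.Theorems.DiagonalMirrorRPRDiagonalSliceModelDefs` (imported); see that file for the docstring.

/-! ## §3 The door-B letters (R1, R2) on an explicit model, and the scheme growth clause -/

section Letters

variable {G : Type} [Group G] [TopologicalSpace G] [IsTopologicalGroup G] [CompactSpace G]
  [MeasurableSpace G] [BorelSpace G] {r : LatticeRep G} {sch : SpeciesScheme (YMSpecies G)}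

variable (r sch)

/-! ### §3b Adapters to the door-B clauses already in the tree (`…Cruxes.HypercubicLimit.CouplingResponse.PolyRenorm`,
`.PolyVolume`, Theorems/MirrorModularBoostsHypercubicLimitCouplingResponseDefsC.lean :116 / :123 — cited, not restated).
`PolyVolume sch` (`a_k⁻¹ ≤ (a_k L_k)^N` eventually) is STRONGER than `SideGrowth`; `PolyRenorm r sch` is the `c`-half of
`TemperateRenormalisation`; the `m`-half (`PolyCounterterm`) is automatic when `m_k` is the torus mean of the bounded density. -/

end Letters

/-! ## §4 Real-analysis core: summability bookkeeping, the diagonal twisted trace bound, the liminf lemma -/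

section Analysis

end Analysis

/-! ## §4b The sector top state is even (multiplet form) — the docket's stub S1, DISCHARGED here -/

/-! ## §5 The core: letters ⇒ the lattice statement -/

section Core

variable {G : Type} [Group G] [TopologicalSpace G] [IsTopologicalGroup G] [CompactSpace G]
  [MeasurableSpace G] [BorelSpace G] {r : LatticeRep G} {sch : SpeciesScheme (YMSpecies G)}

omit [TopologicalSpace G] [IsTopologicalGroup G] [CompactSpace G] [BorelSpace G] in
/-- `a_k · side_k → ∞`. -/
theorem tendsto_a_mul_side (sch : SpeciesScheme (YMSpecies G)) :
    Tendsto (fun k => sch.a k * (sch.side k : ℝ)) atTop atTop := by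
  refine tendsto_atTop_mono (fun k => ?_) sch.tendsto_L
  have ha := (sch.a_pos k).le
  have : (sch.L k : ℝ) ≤ (sch.side k : ℝ) := by
    simp only [SpeciesScheme.side]; push_cast; linarith
  exact mul_le_mul_of_nonneg_left this ha

end Core

/-! ## §6 P6 first: the wrong-sign sector is non-empty and weight-carrying when a pairing is negative -/

section WrongSign

variable {G : Type} [Group G] [TopologicalSpace G] [IsTopologicalGroup G] [CompactSpace G]
  [MeasurableSpace G] [BorelSpace G] {r : LatticeRep G} {sch : SpeciesScheme (YMSpecies G)}

/-- **P6.**  If at some step `k` (where the pairing identity holds) the Gram pairing of a reflected family is NEGATIVE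
— as it is for the landed finite-torus witnesses (`Disproof.lean` §4: `SquareTorusNotSwapRP`, `OddTorusTwist`, the
Ising witness with `pairing = −67184640`) — then the `U`-odd sector of `A_k` is non-empty and carries Gram weight:
some `j` has `sm k j > 0` and `wm F k j > 0`.  So the sign twist is not decorative: the line lives or dies on R1/R2
controlling a sector that provably exists whenever finite-`k` RP fails. -/
theorem oddSector_weight_of_pairing_neg (𝔪 : DiagonalSliceModel r sch) (F : ReflectedFamily) (k : ℕ)
    (h2d : 2 * 𝔪.depth F k < sch.side k)
    (hpair : gramPairing r sch F k * (∑' j, 𝔪.sp k j ^ sch.side k - ∑' j, 𝔪.sm k j ^ sch.side k) =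
      ∑' j, 𝔪.sp k j ^ (sch.side k - 2 * 𝔪.depth F k) * 𝔪.wp F k j -
        ∑' j, 𝔪.sm k j ^ (sch.side k - 2 * 𝔪.depth F k) * 𝔪.wm F k j)
    (hneg : gramPairing r sch F k < 0) : ∃ j, 0 < 𝔪.sm k j ∧ 0 < 𝔪.wm F k j := by
  have hZ := 𝔪.trace_side_pos k
  have hP : 0 ≤ ∑' j, 𝔪.sp k j ^ (sch.side k - 2 * 𝔪.depth F k) * 𝔪.wp F k j :=
    tsum_nonneg fun j => mul_nonneg (pow_nonneg (𝔪.sp_nonneg k j) _) (𝔪.wp_nonneg F k j)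
  have hprod : gramPairing r sch F k * (∑' j, 𝔪.sp k j ^ sch.side k - ∑' j, 𝔪.sm k j ^ sch.side k) < 0 :=
    mul_neg_of_neg_of_pos hneg (by linarith)
  have hN : 0 < ∑' j, 𝔪.sm k j ^ (sch.side k - 2 * 𝔪.depth F k) * 𝔪.wm F k j := by linarith
  by_contra hcon
  push Not at hcon
  have hzero : ∀ j, 𝔪.sm k j ^ (sch.side k - 2 * 𝔪.depth F k) * 𝔪.wm F k j = 0 := by
    intro j
    rcases (𝔪.sm_nonneg k j).eq_or_lt with h0 | hpos
    · rw [← h0, zero_pow (by omega), zero_mul]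
    · have := hcon j hpos
      rw [le_antisymm this (𝔪.wm_nonneg F k j), mul_zero]
  rw [tsum_congr hzero, tsum_zero] at hN
  exact lt_irrefl _ hN

/-- **Toy instance of the mechanism** (in-Lean small check for P6): even sector `{1}`, odd sector `{g}` with
`0 < g < 1`, weights `wp = 0`, `wm = 1`: the numerator `1^M·0 − g^M·1` is NEGATIVE for every `M` (finite-`k` RP fails
at every step) while it tends to `0` as `M → ∞` (asymptotic RP). -/
theorem toy_wrongSign (g : ℝ) (hg0 : 0 < g) (hg1 : g < 1) :
    (∀ M : ℕ, (1 : ℝ) ^ M * 0 - g ^ M * 1 < 0) ∧ Tendsto (fun M : ℕ => (1 : ℝ) ^ M * 0 - g ^ M * 1) atTop (𝓝 0) := by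
  refine ⟨fun M => by simpa using pow_pos hg0 M, ?_⟩
  have h := tendsto_pow_atTop_nhds_zero_of_lt_one hg0.le hg1
  simpa using h.neg

/-- **P6, bookkeeping level (the generic reason the wrong-sign sector is non-empty).**  In the hat-symmetry
bookkeeping of F1_diag the symmetrised half step is `Â = 𝒜Θ` with `𝒜` a POSITIVE Θ-symmetric Markov kernel and `Θ`
the swap-induced label involution; at weak coupling `𝒜 → 1`, so `Â → Θ`, whose `(−1)`-eigenspace (the Θ-odd states)
is half the space.  Smallest instance (one `ℤ₂` link pair): `𝒜 = [[2,1],[1,2]]`, `Θ = [[0,1],[1,0]]`,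
`Â = [[1,2],[2,1]]` has the Θ-odd vector `(1,−1)` as eigenvector with eigenvalue `−1 < 0`: the wrong-sign sector is
NON-EMPTY and `Â` is not PSD (were it PSD for Wilson's slabs, the finite odd torus would be exactly swap-RP,
contradicting `Disproof.Ising3.ising3_swap_pairing_neg` / §4). -/
example : (!![(2:ℤ), 1; 1, 2]) * !![(0:ℤ), 1; 1, 0] = !![(1:ℤ), 2; 2, 1] := by decide

example : (!![(1:ℤ), 2; 2, 1]).mulVec ![1, -1] = (-1 : ℤ) • ![1, -1] := by
  ext i; fin_cases i <;> simp [Matrix.mulVec, dotProduct, Fin.sum_univ_two]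

example : ∃ v : Fin 2 → ℤ, dotProduct v ((!![(1:ℤ), 2; 2, 1]).mulVec v) < 0 :=
  ⟨![1, -1], by simp [Matrix.mulVec, dotProduct, Fin.sum_univ_two]⟩

end WrongSign

/-! ## §7 Stubs F1_diag (construction) and closure; the door-B composition -/

section Stubs

variable {G : Type} [Group G] [TopologicalSpace G] [IsTopologicalGroup G] [CompactSpace G]
  [MeasurableSpace G] [BorelSpace G]

/-- **stub_wilsonDiagonalModel** (F1_diag; size L; the HARDEST stub; deliver it as a DEFINITION
`wilsonDiagonalModel r sch hβ : DiagonalSliceModel r sch`, of which this `Nonempty` is the registered shadow).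
Wilson's measure (`β_k ≥ 0`) on the odd torus of side `S = 2L_k+1` admits the two-sector spectral model.  Slice the
torus by `v = x₀ − x₁ ∈ ZMod S` (the swap `x₀ ↔ x₁` acts by `v ↦ −v`: fixed slice `v = 0`, far pair `±(S−1)/2`
swapped, the far BOND layer fixed — `Disproof.lean` §4 `oddTorus_far_layers_swapped`); in half-integer layer time
(in-slice links at `v`, bond links at `v+½`) Wilson's action has range one, and one `e₀`-step of the slab state is a
product of two Markov half steps `𝒜` (site slab) and `𝓑` (link slab), each Θ-pseudo-symmetric (`Xᵀ = Θ X Θ` for the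
swap-induced involution `Θ`): `Â := 𝒜Θ`, `B̂ := Θ𝓑` are symmetric, `𝒜𝓑 = ÂB̂`
(`WrongSignAnnex.mul_invol_isSymm`, `step_eq_hat_mul_hat`, `seamBlock_isSymm`, landed in `SketchSeat2Annex.lean`),
and `B̂` — the Schur cut of the `(01)` plaquettes — is PSD for `β ≥ 0`.  Put `A := B̂^{1/2} Â B̂^{1/2}`:
self-adjoint, Hilbert–Schmidt (smooth positive kernels on `L²(G^{links of a slab})`), `Tr A^m = Tr (𝒜𝓑)^m ≥ 0` is a
diagonal-torus partition function (positive kernels ⇒ `trace_nonneg`; `Tr A^S = Z_k > 0` ⇒ `trace_side_pos`);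
`sp k ·` / `sm k ·` are the moduli of the nonnegative / negative eigenvalues of `A` (`U = sgn A`), `top k = ‖A‖`.
For a reflected family `F` (supports compact in the OPEN half-space, so eventually at slice distance `≥ ϱ+1` from
`v = 0` and inside the box window, `a_k side_k → ∞`; cf. `eventually_a_mul_lt`, `eventually_lt_window`), swap
covariance of the corner-based species (`smearedLatticeField_swap` pattern) and `Xᵀ = ΘXΘ` give
`⟨ΘY·Y⟩_k · Z_k = Tr (M Aˢ⁻²ᵈ Mᵀ)` with `M = C_Y Â B̂^{1/2}` (`C_Y` = insertion of `Y` times the propagation over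
its `d−1` layers), i.e. `pairing_eq` in the eigenbasis of `A` with `wp, wm = ‖Mᵀψ_j‖² ≥ 0` and `S − 2d` odd; and
`Tr (M A²ᵗ Mᵀ)` is an unnormalised expectation of `Y ⊗ Y^refl` on the diagonal torus of EVEN length `2t+2d` with
positive weights, so `|Y| ≤ B` gives `weight_dom` (`Σ λ^{2t} w ≤ B² Tr A^{2t+2d}`, even powers = moduli).
Sources: Osterwalder–Seiler, Ann. Phys. 110 (1978) §2–3; Seiler LNP 159 Ch. 2; FILS CMP 62 (1978) Thm 2.1; the
landed lattice kit `…StubRpClosureLattice.lean` (`texp_*`, `lattice_psd`, `smearedLatticeField_swap`) and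
`…TorusBridge.lean` (`latticeSchwinger_eq_texp`, `boxConfigEquiv`). -/
theorem stub_wilsonDiagonalModel (r : LatticeRep G) (sch : SpeciesScheme (YMSpecies G))
    (hβ : ∀ k, 0 ≤ sch.β k) : Nonempty (DiagonalSliceModel r sch) := by
  -- κ5 (2026-08-31): DISCHARGED by the LANDED construction of hand-10604-wilsonDiagModel-1/-2: the pinned Wilson diagonal
  -- two-step transfer model (`Theorems/DiagonalMirrorRPRWilsonDiagonalModelPinned.lean`, p830030); statement unchanged.
  exact ⟨WilsonDiagonal.wilsonDiagonalTransferModel r sch hβ⟩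

/-- **stub_closure** (size M).  From the package's lattice → continuum convergence `hconv` on the scheme's OWN torus
(no cover, no `CoverInsensitivity`) and the asymptotic swap-RP `OddTorusSwapPairingLiminf`, reflection positivity of
`S₁` in every diagonal frame: in the canonical frame `R e₀ = c(e₀ − e₁)` (`RpClosure.frame_normal_form`, frame time
`c(x₀ − x₁)`, frame reflection `R⁻¹ ∘ swap₀₁ = θ ∘ R⁻¹`) the OS Gram matrix on slab-ordered compact products is the
`k → ∞` limit of the lattice swap Gram matrices (tensor test functions, `⁰𝒮` by disjoint slabs —
`isOffDiagonal_of_slabs`, `append_slabs`), which are real SYMMETRIC (swap is an automorphism of the odd torus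
preserving Wilson's action), so the Hermitian form at complex coefficients is the sum of two real quadratic forms,
each with `liminf ≥ 0`; closedness of `{z | 0 ≤ re z ∧ im z = 0}` and the landed density / frame reduction
(`isReflectionPositive_pullback`, `psd_frame`, W(B₄) sign flips) finish exactly as in `RpClosure.psd_canonical`. -/
theorem stub_closure (r : LatticeRep G) (sch : SpeciesScheme (YMSpecies G)) (S₁ : SchwingerFamily E4) :
    CurvaturePackage r sch S₁ → OddTorusSwapPairingLiminf r sch → DiagonalFrameRP S₁ := by
  -- κ4 (2026-08-31): DISCHARGED by the LANDED generic transfer of lead-27398-D1 g0 (p827255), whose socket hypothesis is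
  -- the body of `OddTorusSwapPairingLiminf r sch` verbatim; statement unchanged.
  intro hW hsock
  unfold OddTorusSwapPairingLiminf at hsock
  exact Summit.QuantumFields.YangMills.Cruxes.DiagonalMirrorRPR.ParityBridgeColdTraces.RpClosure.diagonalFrameRP_of_curvaturePackage_of_swapPairingLiminf
    r sch S₁ hW hsock

/-- **Door-B composition** (the shape of the door-B item `DiagonalFrameRPOfTwistLetters`): letters R1, R2 on some
model, the growth clause and the package give RP in every diagonal frame.  (NOT a `DiagonalMirrorRPR_of`: the crux as
typed is misstated and is not concluded here.) -/
theorem diagonalFrameRP_of_twistLetters (r : LatticeRep G) (sch : SpeciesScheme (YMSpecies G))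
    (hL : TwistLetters r sch) (hG : Growth r sch) (S₁ : SchwingerFamily E4) (hW : CurvaturePackage r sch S₁) :
    DiagonalFrameRP S₁ := by
  obtain ⟨𝔪, hR1, hR2⟩ := hL
  exact stub_closure r sch S₁ hW (core_of 𝔪 hR1 hR2 hG)

end Stubs

end Summit.QuantumFields.YangMills.Cruxes.DiagonalMirrorRPR.SignTwistedDiagonalTrace

end
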